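import Summits.AtomisticToContinuum.FouriersLaw.Theorems.VanishingNoiseTransferNoisyFourierThomsonWitnessCostsLiouvillianAux1
import Summits.AtomisticToContinuum.FouriersLaw.Theorems.VanishingNoiseTransferNoisyFourierThomsonWitnessMoments
import Summits.AtomisticToContinuum.FouriersLaw.Theorems.VanishingNoiseTransferNoisyFourierThomsonWitnessParity
import Summits.AtomisticToContinuum.FouriersLaw.Theorems.VanishingNoiseTransferNoisyFourierThomsonWitnessParityAux1

/-!
# The site-structured costs of the Thomson witness, I: pointwise growth and structure of the site coefficients
(`--supports` file for crux `VanishingNoiseTransfer.NoisyFourier`, stmt-AtomisticToContinuum-11977, line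
`abel-storage-decay`, stub B `stub_bulkAbelGKPositivity`; part W5a "WitnessL2Sites" of lead c7's Thomson-witness
project, file 1 of 4)

Setting: the pinned anharmonic chain `P = pinnedChain ω₂ lam β γ` (`ω₂ > 0`, `lam, β ≥ 0`), `H` its Hamiltonian on
`L` sites. The Thomson witness (W3, `…ThomsonWitnessBlocks`/`…Sites`) is `v = Σ_bonds (p_i G_{ij} + p_j G'_{ij})
= Σ_m p_m K_m` with the blocks `G_{ij} = p_j² φ'(q_j − q_i) − ∂_{q_j}H φ(q_j − q_i)`,
`G'_{ij} = p_i² φ'(q_j − q_i) + ∂_{q_i}H φ(q_j − q_i)`, `φ(r) = 1/(1 + 3βr²)`, `φ'(r) = −6βr/(1 + 3βr²)²`, and the SITE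
COEFFICIENTS `K_m = Σ_{j = m+1} G_{mj} + Σ_{m = i+1} G'_{im}` (everything written inline; no definitions).
* `abs_dphi_le` (`|φ'| ≤ 1 + 3β`; `|φ| ≤ 1`, `φ'² ≤ 3β` are W5b's `Xv.abs_phi_le_one`, `Xv.dphi_sq_le`);
* `sum_ite_succ_eq`, `sum_ite_pred_eq` — the guarded neighbour sums have at most one term;
* GROWTH IN THE ENERGY (for integrability / `L²(μ_T)` membership via `pinnedChain_memLp_two_of_abs_le`):
  `|V'(q_l − q_k)|, |∂_{q_k}H|, |G_{ij}|, |G'_{ij}|, |K_m| ≤ C (1 + H)³` with `C = C(ω₂, lam, β)` uniformly in `L` and the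
  sites (`abs_dV_le`, `abs_partialQ_hamiltonian_le`, `exists_abs_G_le`, `exists_abs_G'_le`, `exists_abs_K_le`,
  `abs_snd_mul_dphi_le`);
* STRUCTURE: continuity (`continuous_G`, `continuous_G'`, `continuous_K`), `K_{m'} ∘ F_m = K_{m'}` for every momentum
  flip (`K_momentumFlip`) and independence of `K_m` from `p_m` (`K_update_snd`).
Registered helper: `helper_thomsonWitnessSiteCoeffGrowth`. Sequels: `…CostsSitesAux2/3`, `…CostsSites` (uniform moments,
costs (f), (g), (h), `L²` membership). All statements are [folklore]; axioms `propext`, `Classical.choice`, `Quot.sound`.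
-/

noncomputable section

open MeasureTheory
open scoped BigOperators
open Literature.MathematicalPhysics.KineticTheory.HeatConduction
open Summit.AtomisticToContinuum.FouriersLaw.Theorems.ChainVariation
  (pinnedChain_abs_momentum_pow_le_all pinnedChain_abs_coord_le)
open Summit.AtomisticToContinuum.FouriersLaw.Theorems.NoisyFourier.ThomsonWitness.Algebra
  (partialQ_hamiltonian_explicit contDiff_partialQ_hamiltonian partialQ_hamiltonian_update_snd
    contDiff_phi_coord contDiff_dphi_coord)

namespace Summit.AtomisticToContinuum.FouriersLaw.Theorems.NoisyFourier.ThomsonWitness.Costs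

variable {L : ℕ} {ω₂ lam β γ : ℝ}

/-! ### A pointwise bound on `φ'` (`φ² ≤ 1`, `φ'² ≤ 3β` are `Xv.phi_sq_le_one`, `Xv.dphi_sq_le` of W5b) -/

/-- `|φ'(r)| ≤ 1 + 3β` (`β ≥ 0`; from `6β|r| ≤ 3β + 3βr²`). [folklore] -/
theorem abs_dphi_le (hβ : 0 ≤ β) (r : ℝ) : |-(6 * β * r) / (1 + 3 * β * r ^ 2) ^ 2| ≤ 1 + 3 * β := by
  have hβr : 0 ≤ β * r ^ 2 := mul_nonneg hβ (sq_nonneg r)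
  have hD : 1 ≤ 1 + 3 * β * r ^ 2 := by linarith
  rw [abs_div, abs_neg, abs_of_pos (by positivity : (0 : ℝ) < (1 + 3 * β * r ^ 2) ^ 2),
    div_le_iff₀ (by positivity), abs_mul, abs_of_nonneg (by positivity : (0 : ℝ) ≤ 6 * β)]
  have h1 : 6 * β * |r| ≤ 3 * β + 3 * β * r ^ 2 := by
    nlinarith [mul_nonneg hβ (sq_nonneg (|r| - 1)), sq_abs r]
  have h2 : 1 + 3 * β * r ^ 2 ≤ (1 + 3 * β * r ^ 2) ^ 2 := by nlinarith
  nlinarith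

/-! ### Sums over the (at most one) right / left neighbour -/

/-- `Σ_j [j = m + 1] f j` is `f (m + 1)` if `m + 1 < L` and `0` otherwise. [folklore] -/
theorem sum_ite_succ_eq (m : Fin L) (f : Fin L → ℝ) :
    (∑ j : Fin L, if j.val = m.val + 1 then f j else 0) =
      if h : m.val + 1 < L then f ⟨m.val + 1, h⟩ else 0 := by
  split_ifs with h
  · rw [Finset.sum_eq_single_of_mem (⟨m.val + 1, h⟩ : Fin L) (Finset.mem_univ _)]
    · rw [if_pos rfl]
    · intro j _ hj
      rw [if_neg]
      exact fun e => hj (Fin.ext e)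
  · exact Finset.sum_eq_zero fun j _ => if_neg fun e => h (by have := j.isLt; omega)

/-- `Σ_i [m = i + 1] f i` is `f (m - 1)` if `1 ≤ m` and `0` otherwise. [folklore] -/
theorem sum_ite_pred_eq (m : Fin L) (f : Fin L → ℝ) :
    (∑ i : Fin L, if m.val = i.val + 1 then f i else 0) =
      if h : 1 ≤ m.val then f ⟨m.val - 1, by omega⟩ else 0 := by
  split_ifs with h
  · rw [Finset.sum_eq_single_of_mem (⟨m.val - 1, by omega⟩ : Fin L) (Finset.mem_univ _)]
    · rw [if_pos]
      simp only
      omega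
    · intro i _ hi
      rw [if_neg]
      intro e
      apply hi
      ext
      simp only
      omega
  · exact Finset.sum_eq_zero fun i _ => if_neg fun e => h (by omega)
/-! ### Growth in the energy: `|f| ≤ C (1 + H)^k` bounds (for integrability and `L²` membership) -/

section Growth

variable (hω : 0 < ω₂) (hl : 0 ≤ lam) (hβ : 0 ≤ β) (γ : ℝ)
include hω hl hβ

/-- `1 ≤ 1 + H`. [folklore] -/
theorem one_le_one_add_hamiltonian (x : PhaseSpace L) : 1 ≤ 1 + (pinnedChain ω₂ lam β γ).hamiltonian L x := by
  linarith [pinnedChain_hamiltonian_nonneg hω.le hl hβ γ L x]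

/-- `|p_k| ≤ 2(1 + H)`. [folklore] -/
theorem abs_snd_le (x : PhaseSpace L) (k : Fin L) : |x.2 k| ≤ 2 * (1 + (pinnedChain ω₂ lam β γ).hamiltonian L x) := by
  simpa using pinnedChain_abs_momentum_pow_le_all hω hl hβ γ L x k 1

/-- `|V'(q_l - q_k)| = |(q_l - q_k) + β(q_l - q_k)³| ≤ (2c + 8βc³)(1 + H)³`, `c = 1 + ω₂⁻¹`. [folklore] -/
theorem abs_dV_le (x : PhaseSpace L) (k l : Fin L) :
    |(x.1 l - x.1 k) + β * (x.1 l - x.1 k) ^ 3| ≤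
      (2 * (1 + ω₂⁻¹) + 8 * β * (1 + ω₂⁻¹) ^ 3) * (1 + (pinnedChain ω₂ lam β γ).hamiltonian L x) ^ 3 := by
  set M := 1 + (pinnedChain ω₂ lam β γ).hamiltonian L x with hM
  set c := 1 + ω₂⁻¹ with hc
  have hM1 : 1 ≤ M := one_le_one_add_hamiltonian hω hl hβ γ x
  have hc0 : 0 ≤ c := by positivity
  have hr : |x.1 l - x.1 k| ≤ 2 * c * M := by
    have h1 := pinnedChain_abs_coord_le hω hl hβ γ L x l
    have h2 := pinnedChain_abs_coord_le hω hl hβ γ L x k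
    calc |x.1 l - x.1 k| ≤ |x.1 l| + |x.1 k| := abs_sub _ _
      _ ≤ 2 * c * M := by linarith
  have hr3 : |x.1 l - x.1 k| ^ 3 ≤ (2 * c * M) ^ 3 := pow_le_pow_left₀ (abs_nonneg _) hr 3
  have hM3 : M ≤ M ^ 3 := le_self_pow₀ hM1 (by norm_num)
  calc |(x.1 l - x.1 k) + β * (x.1 l - x.1 k) ^ 3|
      ≤ |x.1 l - x.1 k| + β * |x.1 l - x.1 k| ^ 3 := by
        refine (abs_add_le _ _).trans ?_
        rw [abs_mul, abs_of_nonneg hβ, abs_pow]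
    _ ≤ 2 * c * M + β * (2 * c * M) ^ 3 := add_le_add hr (mul_le_mul_of_nonneg_left hr3 hβ)
    _ ≤ (2 * c + 8 * β * c ^ 3) * M ^ 3 := by
        have : 2 * c * M ≤ 2 * c * M ^ 3 := mul_le_mul_of_nonneg_left hM3 (by positivity)
        nlinarith

/-- **Growth of the force**: `|∂_{q_k} H| ≤ C_H (1 + H)³` with
`C_H = ω₂ c + lam c³ + 2(2c + 8βc³)`, `c = 1 + ω₂⁻¹`, uniformly in `L`, `k`. [folklore] -/
theorem abs_partialQ_hamiltonian_le (x : PhaseSpace L) (k : Fin L) :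
    |partialQ k ((pinnedChain ω₂ lam β γ).hamiltonian L) x| ≤
      (ω₂ * (1 + ω₂⁻¹) + lam * (1 + ω₂⁻¹) ^ 3 + 2 * (2 * (1 + ω₂⁻¹) + 8 * β * (1 + ω₂⁻¹) ^ 3)) *
        (1 + (pinnedChain ω₂ lam β γ).hamiltonian L x) ^ 3 := by
  set M := 1 + (pinnedChain ω₂ lam β γ).hamiltonian L x with hM
  set c := 1 + ω₂⁻¹ with hc
  set cV := 2 * c + 8 * β * c ^ 3 with hcV
  have hM1 : 1 ≤ M := one_le_one_add_hamiltonian hω hl hβ γ x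
  have hc0 : 0 ≤ c := by positivity
  have hcV0 : 0 ≤ cV := by positivity
  have hM3 : M ≤ M ^ 3 := le_self_pow₀ hM1 (by norm_num)
  have hq : |x.1 k| ≤ c * M := pinnedChain_abs_coord_le hω hl hβ γ L x k
  have hq3 : |x.1 k| ^ 3 ≤ (c * M) ^ 3 := pow_le_pow_left₀ (abs_nonneg _) hq 3
  -- the two neighbour sums
  have hS1 : |∑ l : Fin L, if l.val = k.val + 1 then ((x.1 l - x.1 k) + β * (x.1 l - x.1 k) ^ 3) else 0| ≤
      cV * M ^ 3 := by
    rw [sum_ite_succ_eq]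
    split_ifs with h
    · exact abs_dV_le hω hl hβ γ x k _
    · rw [abs_zero]; positivity
  have hS2 : |∑ l : Fin L, if k.val = l.val + 1 then ((x.1 k - x.1 l) + β * (x.1 k - x.1 l) ^ 3) else 0| ≤
      cV * M ^ 3 := by
    rw [sum_ite_pred_eq]
    split_ifs with h
    · exact abs_dV_le hω hl hβ γ x _ k
    · rw [abs_zero]; positivity
  rw [partialQ_hamiltonian_explicit]
  have h1 : |ω₂ * x.1 k| ≤ ω₂ * c * M ^ 3 := by
    rw [abs_mul, abs_of_pos hω]
    nlinarith [mul_le_mul_of_nonneg_left hM3 (mul_nonneg hω.le hc0)]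
  have h2 : |lam * x.1 k ^ 3| ≤ lam * c ^ 3 * M ^ 3 := by
    rw [abs_mul, abs_of_nonneg hl, abs_pow]
    nlinarith [mul_le_mul_of_nonneg_left hq3 hl]
  calc _ ≤ |ω₂ * x.1 k| + |lam * x.1 k ^ 3| +
        |∑ l : Fin L, if l.val = k.val + 1 then ((x.1 l - x.1 k) + β * (x.1 l - x.1 k) ^ 3) else 0| +
        |∑ l : Fin L, if k.val = l.val + 1 then ((x.1 k - x.1 l) + β * (x.1 k - x.1 l) ^ 3) else 0| := by
        refine (abs_add_le _ _).trans (add_le_add ((abs_sub _ _).trans (add_le_add (abs_add_le _ _) le_rfl)) le_rfl)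
    _ ≤ ω₂ * c * M ^ 3 + lam * c ^ 3 * M ^ 3 + cV * M ^ 3 + cV * M ^ 3 := by linarith
    _ = _ := by ring

end Growth

section GrowthBlocks

variable (hω : 0 < ω₂) (hl : 0 ≤ lam) (hβ : 0 ≤ β) (γ : ℝ)
include hω hl hβ

/-- **Growth of the block `G_{ij} = p_j² φ'(q_j - q_i) − ∂_{q_j}H φ(q_j - q_i)`** (the coefficient of `p_i` in the
bond term of the witness): `|G_{ij}| ≤ C (1 + H)³` uniformly in `L`, `i`, `j`. [folklore] -/
theorem exists_abs_G_le : ∃ C : ℝ, 0 ≤ C ∧ ∀ (L : ℕ) (i j : Fin L) (x : PhaseSpace L),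
    |x.2 j ^ 2 * (-(6 * β * (x.1 j - x.1 i)) / (1 + 3 * β * (x.1 j - x.1 i) ^ 2) ^ 2) -
        partialQ j ((pinnedChain ω₂ lam β γ).hamiltonian L) x * (1 / (1 + 3 * β * (x.1 j - x.1 i) ^ 2))| ≤
      C * (1 + (pinnedChain ω₂ lam β γ).hamiltonian L x) ^ 3 := by
  set cH := ω₂ * (1 + ω₂⁻¹) + lam * (1 + ω₂⁻¹) ^ 3 + 2 * (2 * (1 + ω₂⁻¹) + 8 * β * (1 + ω₂⁻¹) ^ 3) with hcH
  have hcH0 : 0 ≤ cH := by positivity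
  refine ⟨4 * (1 + 3 * β) + cH, by positivity, fun L i j x => ?_⟩
  set M := 1 + (pinnedChain ω₂ lam β γ).hamiltonian L x with hM
  have hM1 : 1 ≤ M := one_le_one_add_hamiltonian hω hl hβ γ x
  have hp : |x.2 j| ≤ 2 * M := abs_snd_le hω hl hβ γ x j
  have hp2 : x.2 j ^ 2 ≤ (2 * M) ^ 2 := by
    have := pow_le_pow_left₀ (abs_nonneg _) hp 2
    rwa [sq_abs] at this
  have hd := abs_dphi_le hβ (x.1 j - x.1 i)
  have hφ := Xv.abs_phi_le_one hβ (x.1 j - x.1 i)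
  have hH : |partialQ j ((pinnedChain ω₂ lam β γ).hamiltonian L) x| ≤ cH * M ^ 3 :=
    abs_partialQ_hamiltonian_le hω hl hβ γ x j
  have hM23 : M ^ 2 ≤ M ^ 3 := pow_le_pow_right₀ hM1 (by norm_num)
  calc _ ≤ |x.2 j ^ 2 * (-(6 * β * (x.1 j - x.1 i)) / (1 + 3 * β * (x.1 j - x.1 i) ^ 2) ^ 2)| +
        |partialQ j ((pinnedChain ω₂ lam β γ).hamiltonian L) x * (1 / (1 + 3 * β * (x.1 j - x.1 i) ^ 2))| :=
        abs_sub _ _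
    _ = x.2 j ^ 2 * |(-(6 * β * (x.1 j - x.1 i)) / (1 + 3 * β * (x.1 j - x.1 i) ^ 2) ^ 2)| +
        |partialQ j ((pinnedChain ω₂ lam β γ).hamiltonian L) x| * |1 / (1 + 3 * β * (x.1 j - x.1 i) ^ 2)| := by
        rw [abs_mul, abs_mul, abs_of_nonneg (sq_nonneg _)]
    _ ≤ (2 * M) ^ 2 * (1 + 3 * β) + cH * M ^ 3 * 1 :=
        add_le_add (mul_le_mul hp2 hd (abs_nonneg _) (by positivity))
          (mul_le_mul hH hφ (abs_nonneg _) (by positivity))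
    _ ≤ (4 * (1 + 3 * β) + cH) * M ^ 3 := by nlinarith

/-- **Growth of the block `G'_{ij} = p_i² φ'(q_j - q_i) + ∂_{q_i}H φ(q_j - q_i)`** (the coefficient of `p_j`):
`|G'_{ij}| ≤ C (1 + H)³` uniformly in `L`, `i`, `j`. [folklore] -/
theorem exists_abs_G'_le : ∃ C : ℝ, 0 ≤ C ∧ ∀ (L : ℕ) (i j : Fin L) (x : PhaseSpace L),
    |x.2 i ^ 2 * (-(6 * β * (x.1 j - x.1 i)) / (1 + 3 * β * (x.1 j - x.1 i) ^ 2) ^ 2) +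
        partialQ i ((pinnedChain ω₂ lam β γ).hamiltonian L) x * (1 / (1 + 3 * β * (x.1 j - x.1 i) ^ 2))| ≤
      C * (1 + (pinnedChain ω₂ lam β γ).hamiltonian L x) ^ 3 := by
  set cH := ω₂ * (1 + ω₂⁻¹) + lam * (1 + ω₂⁻¹) ^ 3 + 2 * (2 * (1 + ω₂⁻¹) + 8 * β * (1 + ω₂⁻¹) ^ 3) with hcH
  have hcH0 : 0 ≤ cH := by positivity
  refine ⟨4 * (1 + 3 * β) + cH, by positivity, fun L i j x => ?_⟩
  set M := 1 + (pinnedChain ω₂ lam β γ).hamiltonian L x with hM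
  have hM1 : 1 ≤ M := one_le_one_add_hamiltonian hω hl hβ γ x
  have hp : |x.2 i| ≤ 2 * M := abs_snd_le hω hl hβ γ x i
  have hp2 : x.2 i ^ 2 ≤ (2 * M) ^ 2 := by
    have := pow_le_pow_left₀ (abs_nonneg _) hp 2
    rwa [sq_abs] at this
  have hd := abs_dphi_le hβ (x.1 j - x.1 i)
  have hφ := Xv.abs_phi_le_one hβ (x.1 j - x.1 i)
  have hH : |partialQ i ((pinnedChain ω₂ lam β γ).hamiltonian L) x| ≤ cH * M ^ 3 :=
    abs_partialQ_hamiltonian_le hω hl hβ γ x i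
  have hM23 : M ^ 2 ≤ M ^ 3 := pow_le_pow_right₀ hM1 (by norm_num)
  calc _ ≤ |x.2 i ^ 2 * (-(6 * β * (x.1 j - x.1 i)) / (1 + 3 * β * (x.1 j - x.1 i) ^ 2) ^ 2)| +
        |partialQ i ((pinnedChain ω₂ lam β γ).hamiltonian L) x * (1 / (1 + 3 * β * (x.1 j - x.1 i) ^ 2))| :=
        abs_add_le _ _
    _ = x.2 i ^ 2 * |(-(6 * β * (x.1 j - x.1 i)) / (1 + 3 * β * (x.1 j - x.1 i) ^ 2) ^ 2)| +
        |partialQ i ((pinnedChain ω₂ lam β γ).hamiltonian L) x| * |1 / (1 + 3 * β * (x.1 j - x.1 i) ^ 2)| := by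
        rw [abs_mul, abs_mul, abs_of_nonneg (sq_nonneg _)]
    _ ≤ (2 * M) ^ 2 * (1 + 3 * β) + cH * M ^ 3 * 1 :=
        add_le_add (mul_le_mul hp2 hd (abs_nonneg _) (by positivity))
          (mul_le_mul hH hφ (abs_nonneg _) (by positivity))
    _ ≤ (4 * (1 + 3 * β) + cH) * M ^ 3 := by nlinarith

/-- **Growth of the site coefficient `K_m = G_{m,m+1}[m+1<L] + G'_{m−1,m}[1≤m]`** of the witness `v = Σ_m p_m K_m`:
`|K_m| ≤ C (1 + H)³` uniformly in `L`, `m`. [folklore] -/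
theorem exists_abs_K_le : ∃ C : ℝ, 0 ≤ C ∧ ∀ (L : ℕ) (m : Fin L) (x : PhaseSpace L),
    |(∑ j : Fin L, if j.val = m.val + 1 then
        (x.2 j ^ 2 * (-(6 * β * (x.1 j - x.1 m)) / (1 + 3 * β * (x.1 j - x.1 m) ^ 2) ^ 2) -
          partialQ j ((pinnedChain ω₂ lam β γ).hamiltonian L) x * (1 / (1 + 3 * β * (x.1 j - x.1 m) ^ 2))) else 0) +
      (∑ i : Fin L, if m.val = i.val + 1 then
        (x.2 i ^ 2 * (-(6 * β * (x.1 m - x.1 i)) / (1 + 3 * β * (x.1 m - x.1 i) ^ 2) ^ 2) +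
          partialQ i ((pinnedChain ω₂ lam β γ).hamiltonian L) x * (1 / (1 + 3 * β * (x.1 m - x.1 i) ^ 2))) else 0)| ≤
      C * (1 + (pinnedChain ω₂ lam β γ).hamiltonian L x) ^ 3 := by
  obtain ⟨C₁, hC₁0, hC₁⟩ := exists_abs_G_le hω hl hβ γ
  obtain ⟨C₂, hC₂0, hC₂⟩ := exists_abs_G'_le hω hl hβ γ
  refine ⟨C₁ + C₂, by positivity, fun L m x => ?_⟩
  have hM0 : 0 ≤ (1 + (pinnedChain ω₂ lam β γ).hamiltonian L x) ^ 3 :=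
    pow_nonneg (zero_le_one.trans (one_le_one_add_hamiltonian hω hl hβ γ x)) 3
  rw [sum_ite_succ_eq, sum_ite_pred_eq, add_mul]
  refine (abs_add_le _ _).trans (add_le_add ?_ ?_)
  · split_ifs with h
    · exact hC₁ L m _ x
    · rw [abs_zero]; positivity
  · split_ifs with h
    · exact hC₂ L _ m x
    · rw [abs_zero]; positivity

end GrowthBlocks

/-! ### Continuity, independence of `p_m`, evenness under the momentum flips -/

section Structure

/-- The block `G_{ij}` is continuous (`β ≥ 0`). [folklore] -/
theorem continuous_G (hβ : 0 ≤ β) (i j : Fin L) : Continuous fun x : PhaseSpace L =>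
    x.2 j ^ 2 * (-(6 * β * (x.1 j - x.1 i)) / (1 + 3 * β * (x.1 j - x.1 i) ^ 2) ^ 2) -
      partialQ j ((pinnedChain ω₂ lam β γ).hamiltonian L) x * (1 / (1 + 3 * β * (x.1 j - x.1 i) ^ 2)) :=
  ((((continuous_apply j).comp continuous_snd).pow 2).mul (contDiff_dphi_coord hβ i j (n := 0)).continuous).sub
    ((contDiff_partialQ_hamiltonian (ω₂ := ω₂) (lam := lam) (γ := γ) j).continuous.mul
      (contDiff_phi_coord hβ i j (n := 0)).continuous)

/-- The block `G'_{ij}` is continuous (`β ≥ 0`). [folklore] -/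
theorem continuous_G' (hβ : 0 ≤ β) (i j : Fin L) : Continuous fun x : PhaseSpace L =>
    x.2 i ^ 2 * (-(6 * β * (x.1 j - x.1 i)) / (1 + 3 * β * (x.1 j - x.1 i) ^ 2) ^ 2) +
      partialQ i ((pinnedChain ω₂ lam β γ).hamiltonian L) x * (1 / (1 + 3 * β * (x.1 j - x.1 i) ^ 2)) :=
  ((((continuous_apply i).comp continuous_snd).pow 2).mul (contDiff_dphi_coord hβ i j (n := 0)).continuous).add
    ((contDiff_partialQ_hamiltonian (ω₂ := ω₂) (lam := lam) (γ := γ) i).continuous.mul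
      (contDiff_phi_coord hβ i j (n := 0)).continuous)

/-- The site coefficient `K_m` is continuous (`β ≥ 0`). [folklore] -/
theorem continuous_K (hβ : 0 ≤ β) (m : Fin L) : Continuous fun x : PhaseSpace L =>
    (∑ j : Fin L, if j.val = m.val + 1 then
        (x.2 j ^ 2 * (-(6 * β * (x.1 j - x.1 m)) / (1 + 3 * β * (x.1 j - x.1 m) ^ 2) ^ 2) -
          partialQ j ((pinnedChain ω₂ lam β γ).hamiltonian L) x * (1 / (1 + 3 * β * (x.1 j - x.1 m) ^ 2))) else 0) +
      (∑ i : Fin L, if m.val = i.val + 1 then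
        (x.2 i ^ 2 * (-(6 * β * (x.1 m - x.1 i)) / (1 + 3 * β * (x.1 m - x.1 i) ^ 2) ^ 2) +
          partialQ i ((pinnedChain ω₂ lam β γ).hamiltonian L) x * (1 / (1 + 3 * β * (x.1 m - x.1 i) ^ 2))) else 0) := by
  refine (continuous_finsetSum _ fun j _ => ?_).add (continuous_finsetSum _ fun i _ => ?_)
  · by_cases h : j.val = m.val + 1
    · simp only [h, if_true]
      exact continuous_G hβ m j
    · simp only [h, if_false]
      exact continuous_const
  · by_cases h : m.val = i.val + 1
    · simp only [h, if_true]
      exact continuous_G' hβ i m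
    · simp only [h, if_false]
      exact continuous_const

/-- `K_{m'}` is even under every momentum flip `F_m` (stated for the site-coefficient FUNCTION `(m', y) ↦ K_{m'}(y)`
applied to `F_m x`, so that it can be fed to the parity toolkit verbatim). [folklore] -/
theorem K_momentumFlip (m' m : Fin L) (x : PhaseSpace L) :
    (fun (m' : Fin L) (y : PhaseSpace L) =>
      (∑ j : Fin L, if j.val = m'.val + 1 then
        (y.2 j ^ 2 * (-(6 * β * (y.1 j - y.1 m')) / (1 + 3 * β * (y.1 j - y.1 m') ^ 2) ^ 2) -
          partialQ j ((pinnedChain ω₂ lam β γ).hamiltonian L) y * (1 / (1 + 3 * β * (y.1 j - y.1 m') ^ 2))) else 0) +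
      (∑ i : Fin L, if m'.val = i.val + 1 then
        (y.2 i ^ 2 * (-(6 * β * (y.1 m' - y.1 i)) / (1 + 3 * β * (y.1 m' - y.1 i) ^ 2) ^ 2) +
          partialQ i ((pinnedChain ω₂ lam β γ).hamiltonian L) y * (1 / (1 + 3 * β * (y.1 m' - y.1 i) ^ 2))) else 0))
      m' (momentumFlip m x) =
    (fun (m' : Fin L) (y : PhaseSpace L) =>
      (∑ j : Fin L, if j.val = m'.val + 1 then
        (y.2 j ^ 2 * (-(6 * β * (y.1 j - y.1 m')) / (1 + 3 * β * (y.1 j - y.1 m') ^ 2) ^ 2) -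
          partialQ j ((pinnedChain ω₂ lam β γ).hamiltonian L) y * (1 / (1 + 3 * β * (y.1 j - y.1 m') ^ 2))) else 0) +
      (∑ i : Fin L, if m'.val = i.val + 1 then
        (y.2 i ^ 2 * (-(6 * β * (y.1 m' - y.1 i)) / (1 + 3 * β * (y.1 m' - y.1 i) ^ 2) ^ 2) +
          partialQ i ((pinnedChain ω₂ lam β γ).hamiltonian L) y * (1 / (1 + 3 * β * (y.1 m' - y.1 i) ^ 2))) else 0))
      m' x := by
  simp only [momentumFlip_fst, Parity.momentumFlip_snd_sq, Parity.partialQ_hamiltonian_momentumFlip]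

/-- `K_m` does not depend on `p_m` (same functional form). [folklore] -/
theorem K_update_snd (m : Fin L) (x : PhaseSpace L) (t : ℝ) :
    (fun (m' : Fin L) (y : PhaseSpace L) =>
      (∑ j : Fin L, if j.val = m'.val + 1 then
        (y.2 j ^ 2 * (-(6 * β * (y.1 j - y.1 m')) / (1 + 3 * β * (y.1 j - y.1 m') ^ 2) ^ 2) -
          partialQ j ((pinnedChain ω₂ lam β γ).hamiltonian L) y * (1 / (1 + 3 * β * (y.1 j - y.1 m') ^ 2))) else 0) +
      (∑ i : Fin L, if m'.val = i.val + 1 then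
        (y.2 i ^ 2 * (-(6 * β * (y.1 m' - y.1 i)) / (1 + 3 * β * (y.1 m' - y.1 i) ^ 2) ^ 2) +
          partialQ i ((pinnedChain ω₂ lam β γ).hamiltonian L) y * (1 / (1 + 3 * β * (y.1 m' - y.1 i) ^ 2))) else 0))
      m (x.1, Function.update x.2 m t) =
    (fun (m' : Fin L) (y : PhaseSpace L) =>
      (∑ j : Fin L, if j.val = m'.val + 1 then
        (y.2 j ^ 2 * (-(6 * β * (y.1 j - y.1 m')) / (1 + 3 * β * (y.1 j - y.1 m') ^ 2) ^ 2) -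
          partialQ j ((pinnedChain ω₂ lam β γ).hamiltonian L) y * (1 / (1 + 3 * β * (y.1 j - y.1 m') ^ 2))) else 0) +
      (∑ i : Fin L, if m'.val = i.val + 1 then
        (y.2 i ^ 2 * (-(6 * β * (y.1 m' - y.1 i)) / (1 + 3 * β * (y.1 m' - y.1 i) ^ 2) ^ 2) +
          partialQ i ((pinnedChain ω₂ lam β γ).hamiltonian L) y * (1 / (1 + 3 * β * (y.1 m' - y.1 i) ^ 2))) else 0))
      m x := by
  beta_reduce
  congr 1
  · refine Finset.sum_congr rfl fun j _ => ?_
    by_cases h : j.val = m.val + 1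
    · have hne : j ≠ m := fun e => by rw [e] at h; omega
      rw [if_pos h, if_pos h]
      simp only [Function.update_of_ne hne, partialQ_hamiltonian_update_snd]
    · rw [if_neg h, if_neg h]
  · refine Finset.sum_congr rfl fun i _ => ?_
    by_cases h : m.val = i.val + 1
    · have hne : i ≠ m := fun e => by rw [e] at h; omega
      rw [if_pos h, if_pos h]
      simp only [Function.update_of_ne hne, partialQ_hamiltonian_update_snd]
    · rw [if_neg h, if_neg h]

end Structure

/-! ### Registered helper -/

/-- Registered helper sub-goal `helper_thomsonWitnessSiteCoeffGrowth` of crux stmt-AtomisticToContinuum-11977 (line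
`abel-storage-decay`, stub B `stub_bulkAbelGKPositivity`, part W5a): growth of the site coefficients of the Thomson
witness in the energy, `|K_m| ≤ C (1 + H)³` uniformly in `L`, `m` (`exists_abs_K_le`, restated notation-free).
[folklore] -/
theorem helper_thomsonWitnessSiteCoeffGrowth : ∀ (ω₂ lam β γ : ℝ), 0 < ω₂ → 0 ≤ lam → 0 ≤ β → ∃ C : ℝ, 0 ≤ C ∧ ∀ (L : ℕ) (m : Fin L) (x : Literature.MathematicalPhysics.KineticTheory.HeatConduction.PhaseSpace L), |(∑ j : Fin L, if j.val = m.val + 1 then (x.2 j ^ 2 * (-(6 * β * (x.1 j - x.1 m)) / (1 + 3 * β * (x.1 j - x.1 m) ^ 2) ^ 2) - Literature.MathematicalPhysics.KineticTheory.HeatConduction.partialQ j ((Literature.MathematicalPhysics.KineticTheory.HeatConduction.pinnedChain ω₂ lam β γ).hamiltonian L) x * (1 / (1 + 3 * β * (x.1 j - x.1 m) ^ 2))) else 0) + (∑ i : Fin L, if m.val = i.val + 1 then (x.2 i ^ 2 * (-(6 * β * (x.1 m - x.1 i)) / (1 + 3 * β * (x.1 m - x.1 i) ^ 2) ^ 2)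 + Literature.MathematicalPhysics.KineticTheory.HeatConduction.partialQ i ((Literature.MathematicalPhysics.KineticTheory.HeatConduction.pinnedChain ω₂ lam β γ).hamiltonian L) x * (1 / (1 + 3 * β * (x.1 m - x.1 i) ^ 2))) else 0)| ≤ C * (1 + (Literature.MathematicalPhysics.KineticTheory.HeatConduction.pinnedChain ω₂ lam β γ).hamiltonian L x) ^ 3 :=
  fun _ _ _ γ hω hl hβ => exists_abs_K_le hω hl hβ γ

end Summit.AtomisticToContinuum.FouriersLaw.Theorems.NoisyFourier.ThomsonWitness.Costs

end
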